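import Mathlib
import HarnessLib
import Summits.HubbardSuperconductivity.HubbardSuperconductivity.Theorems.KLProgrammeKLRegimeSectorSliceAlphaFatRows
import Summits.HubbardSuperconductivity.HubbardSuperconductivity.Theorems.KLProgrammeKLRegimeEngineScaleWtSliceRows

/-!
# Route `KLProgramme` — engine support, route (L2), FAT layer, WEIGHTED: **`α_w` for the FAT sector family on an admissible frame** — the
# `klScaleWt`-weighted row and column sums of `S(F̃)ᵀ·C^K_{(Λ,Λ′]}·S(F̃)` (the `hrow/hcol` binders of `EngineV8.klNormsStepWt_of_sliceConsts`)

Cell `gate-hubbard-kl`, seat p3 (g10); program «W3α = α_w rows instance» (KL STATUS 2026-08-27 20:43Z), file (α3): weighted twin of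
k3c2-p3's `…SectorSliceAlphaFatRows`, on the `klScaleWt`-currency row lemmas of `…EngineScaleWtSliceRows` (p3 g9) and the weighted per-pair
bound `slicePairWt_bgmFat_le` (file (α1)).

* §1 (generic family `F : Fin N → …`): **`rowSumWt_norm_pullback_sliceCT_le_alpha`**, **`colSumWt_norm_pullback_sliceCT_le_alpha`** — if the
  MOMENT-weighted (`w_{nw}`, scale `nw`, `e₀ = klE0`) per-pair sums are `≤ T_max` on adjacent pairs, the products vanish on non-adjacent pairs and
  every sector has `≤ novl` neighbours, then `Σ_{Y′} ‖C′ Y Y′‖·klScaleWt nw {pos Y, pos Y′} ≤ 8·novl·T_max` (and the column twin);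
* §2 (fat family, weight scale `nw` dominated by the rates: `Λ_{nw}β/(2M) ≤ D·s₀`, `Λ_{nw} ≤ D·s₁`, `1 ≤ D`): **`slicePairWt_bgmFat_le_all`**
  (integer frame vector built from the sector's Fermi point, as in `slicePair_bgmFat_le_all`), **`rowSumWt_sliceCT_bgmFat_le`**,
  **`colSumWt_sliceCT_bgmFat_le`** — `α_w = 72·D·T_max` with `T_max` the uniform bound of `slicePairWt_bgmFat_le`.

Everything is proved; no definitions, no named facts. [folklore] (BGM 2006 §2.8 (2.81), §3 (3.3), Lemma 2.2.)
-/

noncomputable section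

namespace Summit.HubbardSuperconductivity.HubbardSuperconductivity.Theorems.TorusFourierL2

set_option linter.dupNamespace false -- summit = problem name (single-conjunct summit), D-0017

open Set Finset Literature.MathematicalPhysics.QuantumLattice Literature.MathematicalPhysics.QuantumLattice.BandSectorCounting
open Literature.MathematicalPhysics.QuantumLattice.FermiRG Literature.Probability.LatticeModels Literature.Analysis.SpecialFunctions
open Summit.HubbardSuperconductivity.HubbardSuperconductivity.Theorems.DispersionFlow
open Summit.HubbardSuperconductivity.HubbardSuperconductivity.Theorems.KLRegimeSplit
open Summit.HubbardSuperconductivity.HubbardSuperconductivity.Theorems.KLProgrammeLegKernels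
open Summit.HubbardSuperconductivity.HubbardSuperconductivity.Theorems.PerturbedFermiCurve
open Summit.HubbardSuperconductivity.HubbardSuperconductivity.Theorems.EngineV8
open scoped Real Nat

open Classical

/-! ### §1 Generic: weighted `α` from weighted per-pair bounds and an overlap count -/

section Generic

variable {L M N : ℕ} [NeZero L] [NeZero M]

/-- **Weighted row sums: `α_w = 8·novl·T_max`** from MOMENT-weighted per-pair bounds on adjacent pairs (weight scale `nw`).
[cite: BenfattoGiulianiMastropietro2006, §2.8 (2.81), §3 (3.3)] -/
theorem rowSumWt_norm_pullback_sliceCT_le_alpha {β : ℝ} (hβ : 0 < β) (μ : ℝ) (K : TrigPolyC4v) (Λ Λ' : ℝ) (nw : ℕ)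
    (F : Fin N → FreqMomentum L M → ℂ) (Adj : Fin N → Fin N → Prop) [DecidableRel Adj] {Tmax : ℝ} (hTmax : 0 ≤ Tmax)
    (hT : ∀ ω ω', Adj ω ω' → ∑ z : TorusSite 1 (2 * M) × TorusSite 2 L,
        (1 + klScale klE0 nw * β / (2 * M) * |(((z.1 0).valMinAbs : ℤ) : ℝ)| + klScale klE0 nw * |(((z.2 0).valMinAbs : ℤ) : ℝ)| +
          klScale klE0 nw * |(((z.2 1).valMinAbs : ℤ) : ℝ)|) *
        ‖∑ q : TorusSite 1 (2 * M) × TorusSite 2 L, (torusChar q.1 z.1 * torusChar q.2 z.2) •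
          ((((1 / (β * (L : ℝ) ^ 2) : ℝ) : ℂ) ^ 2 *
            (F ω (⟨(q.1 0).val, ZMod.val_lt (q.1 0)⟩, q.2) * F ω' (⟨(q.1 0).val, ZMod.val_lt (q.1 0)⟩, q.2) *
              sliceSymbolFnXi (β * (L : ℝ) ^ 2) 0 Λ Λ' (matsubaraFreq β M ⟨(q.1 0).val, ZMod.val_lt (q.1 0)⟩)
                (nambuXiCT L μ K q.2))))‖ ≤ Tmax)
    (hdisj : ∀ ω ω', ¬ Adj ω ω' → ∀ k : FreqMomentum L M, F ω k * F ω' k = 0)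
    {novl : ℕ} (hcard : ∀ ω, (univ.filter fun ω' => Adj ω ω').card ≤ novl) (Y : SpaceTimeIdx L M × SectorLeg N) :
    ∑ Y' : SpaceTimeIdx L M × SectorLeg N,
        ‖((sectorSubMatrix L M β F).transpose * hubbardCovSliceCT L M β μ 0 K Λ Λ' * sectorSubMatrix L M β F) Y Y'‖ *
          klScaleWt L M β nw {latticeLegPos (2 * (2 * M)) Y, latticeLegPos (2 * (2 * M)) Y'} ≤
      8 * (novl * Tmax) := by
  refine (rowSum_klScaleWt_sliceCT_le hβ μ K Λ Λ' nw F Y).trans (mul_le_mul_of_nonneg_left ?_ (by norm_num))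
  set T : Fin N → Fin N → ℝ := fun ω ω' => ∑ z : TorusSite 1 (2 * M) × TorusSite 2 L,
    (1 + klScale klE0 nw * β / (2 * M) * |(((z.1 0).valMinAbs : ℤ) : ℝ)| + klScale klE0 nw * |(((z.2 0).valMinAbs : ℤ) : ℝ)| +
      klScale klE0 nw * |(((z.2 1).valMinAbs : ℤ) : ℝ)|) *
    ‖∑ q : TorusSite 1 (2 * M) × TorusSite 2 L, (torusChar q.1 z.1 * torusChar q.2 z.2) •
      ((((1 / (β * (L : ℝ) ^ 2) : ℝ) : ℂ) ^ 2 *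
        (F ω (⟨(q.1 0).val, ZMod.val_lt (q.1 0)⟩, q.2) * F ω' (⟨(q.1 0).val, ZMod.val_lt (q.1 0)⟩, q.2) *
          sliceSymbolFnXi (β * (L : ℝ) ^ 2) 0 Λ Λ' (matsubaraFreq β M ⟨(q.1 0).val, ZMod.val_lt (q.1 0)⟩)
            (nambuXiCT L μ K q.2))))‖ with hTdef
  have hzero : ∀ ω ω', ¬ Adj ω ω' → T ω ω' = 0 := by
    intro ω ω' h
    rw [hTdef]
    refine Finset.sum_eq_zero fun z _ => ?_
    have h0 : (∑ q : TorusSite 1 (2 * M) × TorusSite 2 L, (torusChar q.1 z.1 * torusChar q.2 z.2) •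
        ((((1 / (β * (L : ℝ) ^ 2) : ℝ) : ℂ) ^ 2 *
          (F ω (⟨(q.1 0).val, ZMod.val_lt (q.1 0)⟩, q.2) * F ω' (⟨(q.1 0).val, ZMod.val_lt (q.1 0)⟩, q.2) *
            sliceSymbolFnXi (β * (L : ℝ) ^ 2) 0 Λ Λ' (matsubaraFreq β M ⟨(q.1 0).val, ZMod.val_lt (q.1 0)⟩) (nambuXiCT L μ K q.2))))) = 0 :=
      Finset.sum_eq_zero fun q _ => by rw [hdisj ω ω' h _, zero_mul, mul_zero, smul_zero]
    rw [h0, norm_zero, mul_zero]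
  have hTle : ∀ ω ω', T ω ω' ≤ Tmax := by
    intro ω ω'
    by_cases h : Adj ω ω'
    · exact hT ω ω' h
    · rw [hzero ω ω' h]; exact hTmax
  exact sum_pair_le_of_overlap T Adj hTmax hTle hzero hcard Y.2.1.1

/-- **Weighted column sums: `α_w = 8·novl·T_max`** (adjacency counted in the first slot). [cite: BenfattoGiulianiMastropietro2006, §2.8 (2.81)] -/
theorem colSumWt_norm_pullback_sliceCT_le_alpha {β : ℝ} (hβ : 0 < β) (μ : ℝ) (K : TrigPolyC4v) (Λ Λ' : ℝ) (nw : ℕ)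
    (F : Fin N → FreqMomentum L M → ℂ) (Adj : Fin N → Fin N → Prop) [DecidableRel Adj] {Tmax : ℝ} (hTmax : 0 ≤ Tmax)
    (hT : ∀ ω ω', Adj ω ω' → ∑ z : TorusSite 1 (2 * M) × TorusSite 2 L,
        (1 + klScale klE0 nw * β / (2 * M) * |(((z.1 0).valMinAbs : ℤ) : ℝ)| + klScale klE0 nw * |(((z.2 0).valMinAbs : ℤ) : ℝ)| +
          klScale klE0 nw * |(((z.2 1).valMinAbs : ℤ) : ℝ)|) *
        ‖∑ q : TorusSite 1 (2 * M) × TorusSite 2 L, (torusChar q.1 z.1 * torusChar q.2 z.2) •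
          ((((1 / (β * (L : ℝ) ^ 2) : ℝ) : ℂ) ^ 2 *
            (F ω (⟨(q.1 0).val, ZMod.val_lt (q.1 0)⟩, q.2) * F ω' (⟨(q.1 0).val, ZMod.val_lt (q.1 0)⟩, q.2) *
              sliceSymbolFnXi (β * (L : ℝ) ^ 2) 0 Λ Λ' (matsubaraFreq β M ⟨(q.1 0).val, ZMod.val_lt (q.1 0)⟩)
                (nambuXiCT L μ K q.2))))‖ ≤ Tmax)
    (hdisj : ∀ ω ω', ¬ Adj ω ω' → ∀ k : FreqMomentum L M, F ω k * F ω' k = 0)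
    {novl : ℕ} (hcard : ∀ ω', (univ.filter fun ω => Adj ω ω').card ≤ novl) (Y' : SpaceTimeIdx L M × SectorLeg N) :
    ∑ Y : SpaceTimeIdx L M × SectorLeg N,
        ‖((sectorSubMatrix L M β F).transpose * hubbardCovSliceCT L M β μ 0 K Λ Λ' * sectorSubMatrix L M β F) Y Y'‖ *
          klScaleWt L M β nw {latticeLegPos (2 * (2 * M)) Y, latticeLegPos (2 * (2 * M)) Y'} ≤
      8 * (novl * Tmax) := by
  refine (colSum_klScaleWt_sliceCT_le hβ μ K Λ Λ' nw F Y').trans (mul_le_mul_of_nonneg_left ?_ (by norm_num))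
  set T : Fin N → Fin N → ℝ := fun ω ω' => ∑ z : TorusSite 1 (2 * M) × TorusSite 2 L,
    (1 + klScale klE0 nw * β / (2 * M) * |(((z.1 0).valMinAbs : ℤ) : ℝ)| + klScale klE0 nw * |(((z.2 0).valMinAbs : ℤ) : ℝ)| +
      klScale klE0 nw * |(((z.2 1).valMinAbs : ℤ) : ℝ)|) *
    ‖∑ q : TorusSite 1 (2 * M) × TorusSite 2 L, (torusChar q.1 z.1 * torusChar q.2 z.2) •
      ((((1 / (β * (L : ℝ) ^ 2) : ℝ) : ℂ) ^ 2 *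
        (F ω (⟨(q.1 0).val, ZMod.val_lt (q.1 0)⟩, q.2) * F ω' (⟨(q.1 0).val, ZMod.val_lt (q.1 0)⟩, q.2) *
          sliceSymbolFnXi (β * (L : ℝ) ^ 2) 0 Λ Λ' (matsubaraFreq β M ⟨(q.1 0).val, ZMod.val_lt (q.1 0)⟩)
            (nambuXiCT L μ K q.2))))‖ with hTdef
  have hzero : ∀ ω ω', ¬ Adj ω ω' → T ω ω' = 0 := by
    intro ω ω' h
    rw [hTdef]
    refine Finset.sum_eq_zero fun z _ => ?_
    have h0 : (∑ q : TorusSite 1 (2 * M) × TorusSite 2 L, (torusChar q.1 z.1 * torusChar q.2 z.2) •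
        ((((1 / (β * (L : ℝ) ^ 2) : ℝ) : ℂ) ^ 2 *
          (F ω (⟨(q.1 0).val, ZMod.val_lt (q.1 0)⟩, q.2) * F ω' (⟨(q.1 0).val, ZMod.val_lt (q.1 0)⟩, q.2) *
            sliceSymbolFnXi (β * (L : ℝ) ^ 2) 0 Λ Λ' (matsubaraFreq β M ⟨(q.1 0).val, ZMod.val_lt (q.1 0)⟩) (nambuXiCT L μ K q.2))))) = 0 :=
      Finset.sum_eq_zero fun q _ => by rw [hdisj ω ω' h _, zero_mul, mul_zero, smul_zero]
    rw [h0, norm_zero, mul_zero]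
  have hTle : ∀ ω ω', T ω ω' ≤ Tmax := by
    intro ω ω'
    by_cases h : Adj ω ω'
    · exact hT ω ω' h
    · rw [hzero ω ω' h]; exact hTmax
  exact sum_pair_le_of_overlap' T Adj hTmax hTle hzero hcard Y'.2.1.1

omit [NeZero L] [NeZero M] in
/-- **From the rate weight to the moment weight**: if `Λ_{nw}β/(2M) ≤ D·s₀`, `Λ_{nw} ≤ D·s₁` and `1 ≤ D` then
`w_{nw}(z) ≤ D·(1 + s₀|z̃₁| + s₁|z̃₂⁰| + s₁|z̃₂¹|)`. [folklore] -/
theorem momentWt_le_mul_rateWt {β s₀ s₁ D : ℝ} {nw : ℕ} (hD : 1 ≤ D) (hd₀ : klScale klE0 nw * β / (2 * M) ≤ D * s₀)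
    (hd₁ : klScale klE0 nw ≤ D * s₁) (z : TorusSite 1 (2 * M) × TorusSite 2 L) :
    1 + klScale klE0 nw * β / (2 * M) * |(((z.1 0).valMinAbs : ℤ) : ℝ)| + klScale klE0 nw * |(((z.2 0).valMinAbs : ℤ) : ℝ)| +
        klScale klE0 nw * |(((z.2 1).valMinAbs : ℤ) : ℝ)| ≤
      D * (1 + s₀ * |(((z.1 0).valMinAbs : ℤ) : ℝ)| + s₁ * |(((z.2 0).valMinAbs : ℤ) : ℝ)| + s₁ * |(((z.2 1).valMinAbs : ℤ) : ℝ)|) := by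
  have h0 := abs_nonneg (((z.1 0).valMinAbs : ℤ) : ℝ)
  have h1 := abs_nonneg (((z.2 0).valMinAbs : ℤ) : ℝ)
  have h2 := abs_nonneg (((z.2 1).valMinAbs : ℤ) : ℝ)
  have e : D * (1 + s₀ * |(((z.1 0).valMinAbs : ℤ) : ℝ)| + s₁ * |(((z.2 0).valMinAbs : ℤ) : ℝ)| + s₁ * |(((z.2 1).valMinAbs : ℤ) : ℝ)|) =
      D + D * s₀ * |(((z.1 0).valMinAbs : ℤ) : ℝ)| + D * s₁ * |(((z.2 0).valMinAbs : ℤ) : ℝ)| + D * s₁ * |(((z.2 1).valMinAbs : ℤ) : ℝ)| := by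
    ring
  rw [e]
  have t0 := mul_le_mul_of_nonneg_right hd₀ h0
  have t1 := mul_le_mul_of_nonneg_right hd₁ h1
  have t2 := mul_le_mul_of_nonneg_right hd₁ h2
  linarith

end Generic

/-! ### §2 The fat family: `α_w = 72·D·T_max` from a uniform rate-weighted per-pair bound -/

section Fat

variable {L M : ℕ} [NeZero L] [NeZero M]

/-- **`hrow_w` for the fat family from a uniform rate-weighted per-pair bound**: if every pair `(ω, ω′)` at angular scale `m+1` obeys
`Σ_z (1 + s₀|z̃₁| + s₁|z̃₂|₁)·‖S[(βL²)⁻²F̃_ωF̃_{ω′}Ψ̂]‖(z) ≤ T_max` and the weight scale `nw` is dominated by the rates (`Λ_{nw}β/(2M) ≤ D s₀`,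
`Λ_{nw} ≤ D s₁`, `1 ≤ D`), then `Σ_{Y′} ‖(S(F̃)ᵀ C^K_{(Λ,Λ′]} S(F̃)) Y Y′‖·klScaleWt nw {pos Y, pos Y′} ≤ 8·(9·(D·T_max))`.
[cite: BenfattoGiulianiMastropietro2006, §2.8 (2.81), §3 (3.3)] -/
theorem rowSumWt_sliceCT_bgmFat_le_of_pairBound {β : ℝ} (hβ : 0 < β) (μ : ℝ) (K : TrigPolyC4v) (Λ Λ' e₀ : ℝ) (m nw : ℕ)
    {s₀ s₁ D Tmax : ℝ} (hD : 1 ≤ D) (hd₀ : klScale klE0 nw * β / (2 * M) ≤ D * s₀)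
    (hd₁ : klScale klE0 nw ≤ D * s₁) (hTmax : 0 ≤ Tmax)
    (hT : ∀ ω ω' : Fin (sectorCount (m + 1)), ∑ z : TorusSite 1 (2 * M) × TorusSite 2 L,
        (1 + s₀ * |(((z.1 0).valMinAbs : ℤ) : ℝ)| + s₁ * |(((z.2 0).valMinAbs : ℤ) : ℝ)| + s₁ * |(((z.2 1).valMinAbs : ℤ) : ℝ)|) *
        ‖∑ q : TorusSite 1 (2 * M) × TorusSite 2 L, (torusChar q.1 z.1 * torusChar q.2 z.2) •
          ((((1 / (β * (L : ℝ) ^ 2) : ℝ) : ℂ) ^ 2 *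
            (bgmFatMultiplier L M e₀ β (nambuXiCT L μ K) (m + 1) ω (⟨(q.1 0).val, ZMod.val_lt (q.1 0)⟩, q.2) *
              bgmFatMultiplier L M e₀ β (nambuXiCT L μ K) (m + 1) ω' (⟨(q.1 0).val, ZMod.val_lt (q.1 0)⟩, q.2) *
              sliceSymbolFnXi (β * (L : ℝ) ^ 2) 0 Λ Λ' (matsubaraFreq β M ⟨(q.1 0).val, ZMod.val_lt (q.1 0)⟩)
                (nambuXiCT L μ K q.2))))‖ ≤ Tmax)
    (Y : SpaceTimeIdx L M × SectorLeg (sectorCount (m + 1))) :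
    ∑ Y' : SpaceTimeIdx L M × SectorLeg (sectorCount (m + 1)),
        ‖((sectorSubMatrix L M β (bgmFatMultiplier L M e₀ β (nambuXiCT L μ K) (m + 1))).transpose *
            hubbardCovSliceCT L M β μ 0 K Λ Λ' * sectorSubMatrix L M β (bgmFatMultiplier L M e₀ β (nambuXiCT L μ K) (m + 1))) Y Y'‖ *
          klScaleWt L M β nw {latticeLegPos (2 * (2 * M)) Y, latticeLegPos (2 * (2 * M)) Y'} ≤
      8 * ((9 : ℕ) * (D * Tmax)) := by
  have hD0 : 0 ≤ D := zero_le_one.trans hD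
  refine rowSumWt_norm_pullback_sliceCT_le_alpha hβ μ K Λ Λ' nw _
    (fun ω ω' => ∃ k : FreqMomentum L M, bgmFatMultiplier L M e₀ β (nambuXiCT L μ K) (m + 1) ω k *
      bgmFatMultiplier L M e₀ β (nambuXiCT L μ K) (m + 1) ω' k ≠ 0) (by positivity) (fun ω ω' _ => ?_) (fun ω ω' h k => ?_)
    (fun ω => card_overlap_bgmFat_le_nine (L := L) (M := M) (K := K) (μ := μ) (e₀ := e₀) (β := β) m ω) Y
  · calc _ ≤ ∑ z : TorusSite 1 (2 * M) × TorusSite 2 L,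
          (D * (1 + s₀ * |(((z.1 0).valMinAbs : ℤ) : ℝ)| + s₁ * |(((z.2 0).valMinAbs : ℤ) : ℝ)| + s₁ * |(((z.2 1).valMinAbs : ℤ) : ℝ)|)) *
          ‖∑ q : TorusSite 1 (2 * M) × TorusSite 2 L, (torusChar q.1 z.1 * torusChar q.2 z.2) •
            ((((1 / (β * (L : ℝ) ^ 2) : ℝ) : ℂ) ^ 2 *
              (bgmFatMultiplier L M e₀ β (nambuXiCT L μ K) (m + 1) ω (⟨(q.1 0).val, ZMod.val_lt (q.1 0)⟩, q.2) *
                bgmFatMultiplier L M e₀ β (nambuXiCT L μ K) (m + 1) ω' (⟨(q.1 0).val, ZMod.val_lt (q.1 0)⟩, q.2) *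
                sliceSymbolFnXi (β * (L : ℝ) ^ 2) 0 Λ Λ' (matsubaraFreq β M ⟨(q.1 0).val, ZMod.val_lt (q.1 0)⟩)
                  (nambuXiCT L μ K q.2))))‖ :=
          sum_le_sum fun z _ => mul_le_mul_of_nonneg_right (momentWt_le_mul_rateWt hD hd₀ hd₁ z) (norm_nonneg _)
      _ = D * ∑ z : TorusSite 1 (2 * M) × TorusSite 2 L,
          (1 + s₀ * |(((z.1 0).valMinAbs : ℤ) : ℝ)| + s₁ * |(((z.2 0).valMinAbs : ℤ) : ℝ)| + s₁ * |(((z.2 1).valMinAbs : ℤ) : ℝ)|) *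
          ‖∑ q : TorusSite 1 (2 * M) × TorusSite 2 L, (torusChar q.1 z.1 * torusChar q.2 z.2) •
            ((((1 / (β * (L : ℝ) ^ 2) : ℝ) : ℂ) ^ 2 *
              (bgmFatMultiplier L M e₀ β (nambuXiCT L μ K) (m + 1) ω (⟨(q.1 0).val, ZMod.val_lt (q.1 0)⟩, q.2) *
                bgmFatMultiplier L M e₀ β (nambuXiCT L μ K) (m + 1) ω' (⟨(q.1 0).val, ZMod.val_lt (q.1 0)⟩, q.2) *
                sliceSymbolFnXi (β * (L : ℝ) ^ 2) 0 Λ Λ' (matsubaraFreq β M ⟨(q.1 0).val, ZMod.val_lt (q.1 0)⟩)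
                  (nambuXiCT L μ K q.2))))‖ := by
          rw [mul_sum]; exact sum_congr rfl fun z _ => by ring
      _ ≤ D * Tmax := mul_le_mul_of_nonneg_left (hT ω ω') hD0
  · by_contra hk
    exact h ⟨k, hk⟩

/-- **`hcol_w` for the fat family from a uniform rate-weighted per-pair bound**: the column twin. [cite: BenfattoGiulianiMastropietro2006, §2.8 (2.81)] -/
theorem colSumWt_sliceCT_bgmFat_le_of_pairBound {β : ℝ} (hβ : 0 < β) (μ : ℝ) (K : TrigPolyC4v) (Λ Λ' e₀ : ℝ) (m nw : ℕ)
    {s₀ s₁ D Tmax : ℝ} (hD : 1 ≤ D) (hd₀ : klScale klE0 nw * β / (2 * M) ≤ D * s₀)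
    (hd₁ : klScale klE0 nw ≤ D * s₁) (hTmax : 0 ≤ Tmax)
    (hT : ∀ ω ω' : Fin (sectorCount (m + 1)), ∑ z : TorusSite 1 (2 * M) × TorusSite 2 L,
        (1 + s₀ * |(((z.1 0).valMinAbs : ℤ) : ℝ)| + s₁ * |(((z.2 0).valMinAbs : ℤ) : ℝ)| + s₁ * |(((z.2 1).valMinAbs : ℤ) : ℝ)|) *
        ‖∑ q : TorusSite 1 (2 * M) × TorusSite 2 L, (torusChar q.1 z.1 * torusChar q.2 z.2) •
          ((((1 / (β * (L : ℝ) ^ 2) : ℝ) : ℂ) ^ 2 *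
            (bgmFatMultiplier L M e₀ β (nambuXiCT L μ K) (m + 1) ω (⟨(q.1 0).val, ZMod.val_lt (q.1 0)⟩, q.2) *
              bgmFatMultiplier L M e₀ β (nambuXiCT L μ K) (m + 1) ω' (⟨(q.1 0).val, ZMod.val_lt (q.1 0)⟩, q.2) *
              sliceSymbolFnXi (β * (L : ℝ) ^ 2) 0 Λ Λ' (matsubaraFreq β M ⟨(q.1 0).val, ZMod.val_lt (q.1 0)⟩)
                (nambuXiCT L μ K q.2))))‖ ≤ Tmax)
    (Y' : SpaceTimeIdx L M × SectorLeg (sectorCount (m + 1))) :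
    ∑ Y : SpaceTimeIdx L M × SectorLeg (sectorCount (m + 1)),
        ‖((sectorSubMatrix L M β (bgmFatMultiplier L M e₀ β (nambuXiCT L μ K) (m + 1))).transpose *
            hubbardCovSliceCT L M β μ 0 K Λ Λ' * sectorSubMatrix L M β (bgmFatMultiplier L M e₀ β (nambuXiCT L μ K) (m + 1))) Y Y'‖ *
          klScaleWt L M β nw {latticeLegPos (2 * (2 * M)) Y, latticeLegPos (2 * (2 * M)) Y'} ≤
      8 * ((9 : ℕ) * (D * Tmax)) := by
  have hD0 : 0 ≤ D := zero_le_one.trans hD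
  refine colSumWt_norm_pullback_sliceCT_le_alpha hβ μ K Λ Λ' nw _
    (fun ω ω' => ∃ k : FreqMomentum L M, bgmFatMultiplier L M e₀ β (nambuXiCT L μ K) (m + 1) ω k *
      bgmFatMultiplier L M e₀ β (nambuXiCT L μ K) (m + 1) ω' k ≠ 0) (by positivity) (fun ω ω' _ => ?_) (fun ω ω' h k => ?_)
    (fun ω' => card_overlap_bgmFat_le_nine' (L := L) (M := M) (K := K) (μ := μ) (e₀ := e₀) (β := β) m ω') Y'
  · calc _ ≤ ∑ z : TorusSite 1 (2 * M) × TorusSite 2 L,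
          (D * (1 + s₀ * |(((z.1 0).valMinAbs : ℤ) : ℝ)| + s₁ * |(((z.2 0).valMinAbs : ℤ) : ℝ)| + s₁ * |(((z.2 1).valMinAbs : ℤ) : ℝ)|)) *
          ‖∑ q : TorusSite 1 (2 * M) × TorusSite 2 L, (torusChar q.1 z.1 * torusChar q.2 z.2) •
            ((((1 / (β * (L : ℝ) ^ 2) : ℝ) : ℂ) ^ 2 *
              (bgmFatMultiplier L M e₀ β (nambuXiCT L μ K) (m + 1) ω (⟨(q.1 0).val, ZMod.val_lt (q.1 0)⟩, q.2) *
                bgmFatMultiplier L M e₀ β (nambuXiCT L μ K) (m + 1) ω' (⟨(q.1 0).val, ZMod.val_lt (q.1 0)⟩, q.2) *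
                sliceSymbolFnXi (β * (L : ℝ) ^ 2) 0 Λ Λ' (matsubaraFreq β M ⟨(q.1 0).val, ZMod.val_lt (q.1 0)⟩)
                  (nambuXiCT L μ K q.2))))‖ :=
          sum_le_sum fun z _ => mul_le_mul_of_nonneg_right (momentWt_le_mul_rateWt hD hd₀ hd₁ z) (norm_nonneg _)
      _ = D * ∑ z : TorusSite 1 (2 * M) × TorusSite 2 L,
          (1 + s₀ * |(((z.1 0).valMinAbs : ℤ) : ℝ)| + s₁ * |(((z.2 0).valMinAbs : ℤ) : ℝ)| + s₁ * |(((z.2 1).valMinAbs : ℤ) : ℝ)|) *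
          ‖∑ q : TorusSite 1 (2 * M) × TorusSite 2 L, (torusChar q.1 z.1 * torusChar q.2 z.2) •
            ((((1 / (β * (L : ℝ) ^ 2) : ℝ) : ℂ) ^ 2 *
              (bgmFatMultiplier L M e₀ β (nambuXiCT L μ K) (m + 1) ω (⟨(q.1 0).val, ZMod.val_lt (q.1 0)⟩, q.2) *
                bgmFatMultiplier L M e₀ β (nambuXiCT L μ K) (m + 1) ω' (⟨(q.1 0).val, ZMod.val_lt (q.1 0)⟩, q.2) *
                sliceSymbolFnXi (β * (L : ℝ) ^ 2) 0 Λ Λ' (matsubaraFreq β M ⟨(q.1 0).val, ZMod.val_lt (q.1 0)⟩)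
                  (nambuXiCT L μ K q.2))))‖ := by
          rw [mul_sum]; exact sum_congr rfl fun z _ => by ring
      _ ≤ D * Tmax := mul_le_mul_of_nonneg_left (hT ω ω') hD0
  · by_contra hk
    exact h ⟨k, hk⟩

end Fat

end Summit.HubbardSuperconductivity.HubbardSuperconductivity.Theorems.TorusFourierL2

end
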